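import Literature.Computability.QuantumComplexity.MatchgateCliffordAlgebra
import Literature.Computability.Cryptography.QuantumCircuitProofs
import HarnessLib

/-!
# Heisenberg evolution of Majoranas through a nearest-neighbour matchgate circuit

Topic `Literature/Computability/QuantumComplexity`, model namespace `Matchgate`. Proof
infrastructure, part II, of the discharge of `JozsaMiyake2008_thm1` (`MatchgateSimulation.lean`;
part I is `MatchgateCliffordAlgebra.lean`): Jozsa–Miyake 2008 §4, eq. (8) and (10), in the tree's
circuit model (`QCircuit`, `QGate.toMatrix`, `QCircuit.acceptProb`). Everything is proved.

* **`conj_majOp_placeGate_blockEmb`** (JM08 Thm. 3 for ONE placed n.n. allowable gate on `N`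
  wires): `Uᴴ c_p U = ∑_q (embE j (rotOf G))_{pq} c_q`;
* gates of a matchgate gate set `gateSet Op M`: `IsAdj`, `base`, `localGate` (absorbing the
  orientation of the two wires, `placeGate_eq_placeGate_blockEmb`), `gateE` (the `SO(2N)` matrix
  of a placed gate), **`conj_majOp_toMatrix`**, `gateE_mul_transpose`;
* circuits: `rowVec p gates` (the row `p` of `E_T ⋯ E_1`, JM08 eq. (8): "the product of all
  `SO(2n)` matrices corresponding to the individual gates"), **`conj_majOp_circuit`** and
  `rowVec_dotProduct_self` (rows of an orthogonal matrix are unit vectors);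
* the observable: `majOp_mul_majOp_apply_self` (diagonal entries `⟨x|c_p c_q|x⟩` on basis
  states), `re_neg_I_mul_sum_pairDiag` (JM08 eq. (10) on a basis input evaluates to `zExp`) and
  **`acceptProb_eq`**: for a nearest-neighbour circuit of allowable matchgates on `n + m ≥ 1`
  wires run on `|x⟩|0^m⟩`, `p₁ = (1 - zExp (x0^m) v₀ v₁)/2` with `v₀, v₁` the rows `(0,X), (0,Y)`
  of `E_T ⋯ E_1` — Theorem 1 of JM08 in exact real arithmetic (the remaining, algorithmic part —
  dyadic evaluation in polynomial time — is `MatchgateNumerics.lean` /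
  `MatchgateSimulationProofs.lean`).

## References

* R. Jozsa, A. Miyake, *Matchgates and classical simulation of quantum circuits*, Proc. R. Soc. A
  464 (2008) 3089–3106 = arXiv:0804.4050, §4 (Thm. 3, eq. (8), (10), Thm. 4), §5. [JozsaMiyake2008]
-/

namespace Literature.Computability.QuantumComplexity.Matchgate

open Matrix Complex Finset Literature.Computability.Cryptography

variable {N : ℕ}

/-! ### One placed nearest-neighbour allowable gate -/

/-- The block's JW string commutes with a gate placed on the block. [folklore] -/
theorem signDiag_wiresBelow_comm_placeGate_blockEmb (j : ℕ) (h : j + 2 ≤ N) (G : Matrix (QReg 2) (QReg 2) ℂ) :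
    signDiag (wiresBelow j) * placeGate (blockEmb j h) G = placeGate (blockEmb j h) G * signDiag (wiresBelow j) :=
  signDiag_mul_placeGate_comm _ (by
    rintro i hi ⟨a, rfl⟩
    simp only [mem_wiresBelow, blockEmb_apply_val] at hi
    omega) G

/-- **JM08 Theorem 3 for one placed n.n. allowable gate, in-block Majoranas**:
`Uᴴ c_{(j+o, b)} U = ∑_ν (rotOf G)_{(o,b),ν} c_{(j+ν₁, ν₂)}` for `U = G_{[j,j+1]}`.
[cite: JozsaMiyake2008, Thm 3 and §5] -/
theorem conj_majOp_blockEmb {j : ℕ} (h : j + 2 ≤ N) {G : Matrix (QReg 2) (QReg 2) ℂ} (hG : IsMatchgate G)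
    (μ : LIdx) :
    (placeGate (blockEmb j h) G)ᴴ * majOp (blockEmb j h μ.1) μ.2 * placeGate (blockEmb j h) G =
      ∑ ν : LIdx, ((rotOf G μ ν : ℝ) : ℂ) • majOp (blockEmb j h ν.1) ν.2 := by
  rw [majOp_block, ← placeGate_conjTranspose_mg, ← Matrix.mul_assoc,
    ← signDiag_wiresBelow_comm_placeGate_blockEmb, Matrix.mul_assoc, Matrix.mul_assoc,
    ← placeGate_mul_holds, ← placeGate_mul_holds, ← Matrix.mul_assoc, hG.conj_majOp μ,
    placeGate_sum_mg, Finset.mul_sum]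
  refine sum_congr rfl fun ν _ => ?_
  rw [placeGate_smul_mg, Matrix.mul_smul, majOp_block]

/-- **JM08 Theorem 3 for one placed n.n. allowable gate, off-block Majoranas**: they are fixed.
[cite: JozsaMiyake2008, Thm 3 and §5] -/
theorem conj_majOp_blockEmb_of_not_inBlock {j : ℕ} (h : j + 2 ≤ N) {G : Matrix (QReg 2) (QReg 2) ℂ}
    (hG : IsMatchgate G) {i : Fin N} (hi : ¬ InBlock j i) (b : Bool) :
    (placeGate (blockEmb j h) G)ᴴ * majOp i b * placeGate (blockEmb j h) G = majOp i b := by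
  have hU : (placeGate (blockEmb j h) G)ᴴ * placeGate (blockEmb j h) G = 1 := by
    have := Matrix.mem_unitaryGroup_iff'.1 (placeGate_mem_unitaryGroup_holds (blockEmb j h) hG.mem_unitaryGroup)
    rwa [star_eq_conjTranspose] at this
  have hcomm : placeGate (blockEmb j h) G * majOp i b = majOp i b * placeGate (blockEmb j h) G := by
    simp only [InBlock, not_and_or, not_le, not_lt] at hi
    rcases hi with hi | hi
    · exact placeGate_blockEmb_comm_majOp_of_lt j h G i hi b
    · exact placeGate_blockEmb_comm_majOp_of_gt j h hG.mul_zz_comm i hi b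
  rw [Matrix.mul_assoc, ← hcomm, ← Matrix.mul_assoc, hU, Matrix.one_mul]

/-- **JM08 Theorem 3 for one placed n.n. allowable gate, matrix form**:
`Uᴴ c_p U = ∑_q (embE j (rotOf G))_{pq} c_q` for every Majorana `c_p`. [cite: JozsaMiyake2008, Thm 3] -/
theorem conj_majOp_placeGate_blockEmb {j : ℕ} (h : j + 2 ≤ N) {G : Matrix (QReg 2) (QReg 2) ℂ}
    (hG : IsMatchgate G) (p : MIdx N) :
    (placeGate (blockEmb j h) G)ᴴ * majOp p.1 p.2 * placeGate (blockEmb j h) G =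
      ∑ q : MIdx N, ((embE j (rotOf G) p q : ℝ) : ℂ) • majOp q.1 q.2 := by
  by_cases hp : InBlock j p.1
  · rw [sum_mIdx_split j h, sum_eq_zero (s := univ.filter _), add_zero, ← blockIdx_locOf h hp]
    · rw [show (blockIdx j h (locOf j p)).1 = blockEmb j h (locOf j p).1 from rfl,
        show (blockIdx j h (locOf j p)).2 = (locOf j p).2 from rfl, conj_majOp_blockEmb h hG]
      refine sum_congr rfl fun ν _ => ?_
      rw [embE_blockIdx]
      rfl
    · intro q hq
      rw [mem_filter] at hq
      rw [embE_of_not_inBlock' _ _ hq.2, if_neg, Complex.ofReal_zero, zero_smul]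
      rintro rfl; exact hq.2 hp
  · rw [conj_majOp_blockEmb_of_not_inBlock h hG hp]
    simp_rw [embE_of_not_inBlock _ hp]
    simp only [apply_ite Complex.ofReal, Complex.ofReal_one, Complex.ofReal_zero, ite_smul, one_smul,
      zero_smul]
    rw [sum_ite_eq univ p, if_pos (mem_univ p)]

/-! ### Gates of a matchgate gate set on nearest-neighbour lines -/

section gates

variable {Op : Type} {M : Op → Matrix (QReg 2) (QReg 2) ℂ}

/-- The two wires of an embedding `Fin 2 ↪ Fin N` are adjacent (in either orientation).
[cite: JozsaMiyake2008, Thm 1 (i)] -/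
def IsAdj (e : Fin 2 ↪ Fin N) : Prop :=
  ((e 0 : Fin N) : ℕ) + 1 = e 1 ∨ ((e 1 : Fin N) : ℕ) + 1 = e 0

/-- The tree's nearest-neighbour condition on a placed gate symbol is adjacency of its wires.
[cite: JozsaMiyake2008, Thm 1 (i)] -/
theorem isNearestNeighbour_gate_iff (g : Op) (e : Fin 2 ↪ Fin N) :
    Matchgate.IsNearestNeighbour (QGate.gate g e : QGate (gateSet Op M) N) ↔ IsAdj e := Iff.rfl

/-- Oracle gates are not nearest-neighbour matchgates. [cite: JozsaMiyake2008, Thm 1 (i)] -/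
theorem not_isNearestNeighbour_oracle (k : ℕ) (e : Fin (k + 1) ↪ Fin N) :
    ¬ Matchgate.IsNearestNeighbour (QGate.oracle k e : QGate (gateSet Op M) N) := id

/-- The lower of the two wires. [folklore] -/
def base (e : Fin 2 ↪ Fin N) : ℕ := min ((e 0 : Fin N) : ℕ) ((e 1 : Fin N) : ℕ)

/-- An adjacent pair fits in the register. [folklore] -/
theorem base_add_two_le {e : Fin 2 ↪ Fin N} (h : IsAdj e) : base e + 2 ≤ N := by
  have h0 := (e 0).isLt
  have h1 := (e 1).isLt
  unfold base
  rcases h with h | h <;> omega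

/-- A forward adjacent embedding is the block embedding at its base. [folklore] -/
theorem eq_blockEmb_of_fwd {e : Fin 2 ↪ Fin N} (h : ((e 0 : Fin N) : ℕ) + 1 = e 1) :
    e = blockEmb (base e) (base_add_two_le (Or.inl h)) := by
  ext i
  fin_cases i
  · simp only [blockEmb_apply_val, base]
    show ((e 0 : Fin N) : ℕ) = _
    omega
  · simp only [blockEmb_apply_val, base]
    show ((e 1 : Fin N) : ℕ) = _
    omega

/-- A backward adjacent embedding is the swapped block embedding at its base. [folklore] -/
theorem eq_swap_blockEmb_of_bwd {e : Fin 2 ↪ Fin N} (h : ((e 1 : Fin N) : ℕ) + 1 = e 0) :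
    e = wireSwap.toEmbedding.trans (blockEmb (base e) (base_add_two_le (Or.inr h))) := by
  ext i
  fin_cases i
  · simp only [Function.Embedding.trans_apply, Equiv.coe_toEmbedding, blockEmb_apply_val, base]
    show ((e 0 : Fin N) : ℕ) = base e + ((wireSwap 0 : Fin 2) : ℕ)
    simp [base]
    omega
  · simp only [Function.Embedding.trans_apply, Equiv.coe_toEmbedding, blockEmb_apply_val, base]
    show ((e 1 : Fin N) : ℕ) = base e + ((wireSwap 1 : Fin 2) : ℕ)
    simp [base]
    omega

/-- **The local gate of a placed two-qubit gate**: the gate itself if its wires are in forward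
order, its wire exchange `SWAP U SWAP` otherwise. [cite: JozsaMiyake2008, §2 (SWAP G(A,B) SWAP = G(A, XBX))] -/
noncomputable def localGate (U : Matrix (QReg 2) (QReg 2) ℂ) (e : Fin 2 ↪ Fin N) : Matrix (QReg 2) (QReg 2) ℂ :=
  if ((e 0 : Fin N) : ℕ) + 1 = e 1 then U else U.submatrix (fun x => x ∘ wireSwap) (fun x => x ∘ wireSwap)

/-- A gate placed on adjacent wires is its local gate placed on the block at its base.
[cite: JozsaMiyake2008, Thm 1 (i)] -/
theorem placeGate_eq_placeGate_blockEmb {e : Fin 2 ↪ Fin N} (h : IsAdj e) (U : Matrix (QReg 2) (QReg 2) ℂ) :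
    placeGate e U = placeGate (blockEmb (base e) (base_add_two_le h)) (localGate U e) := by
  unfold localGate
  split_ifs with hf
  · conv_lhs => rw [eq_blockEmb_of_fwd hf]
  · have hb : ((e 1 : Fin N) : ℕ) + 1 = e 0 := h.resolve_left hf
    conv_lhs => rw [eq_swap_blockEmb_of_bwd hb]
    rw [placeGate_perm]

/-- The local gate of an allowable matchgate is an allowable matchgate. [cite: JozsaMiyake2008, §2] -/
theorem IsMatchgate.localGate {U : Matrix (QReg 2) (QReg 2) ℂ} (hU : IsMatchgate U) (e : Fin 2 ↪ Fin N) :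
    IsMatchgate (localGate U e) := by
  unfold Matchgate.localGate
  split_ifs
  · exact hU
  · exact hU.submatrix_swap

/-- **The `SO(2N)` matrix of a placed gate** of a matchgate gate set (JM08 §4: the matrix of an
individual gate): the block embedding at its base of the rotation of its local gate; the
identity for oracle gates (which are excluded by the nearest-neighbour hypothesis). [cite: JozsaMiyake2008, §4 eq. (8)] -/
noncomputable def gateE : QGate (gateSet Op M) N → Matrix (MIdx N) (MIdx N) ℝ
  | .gate g e => embE (base e) (rotOf (localGate (M g) e))
  | .oracle _ _ => 1

/-- **JM08 Theorem 3 for one gate of a nearest-neighbour matchgate circuit.**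
[cite: JozsaMiyake2008, Thm 3 and §5] -/
theorem conj_majOp_toMatrix (hM : ∀ g, IsMatchgate (M g)) {q : QGate (gateSet Op M) N}
    (hq : Matchgate.IsNearestNeighbour q) (p : MIdx N) :
    (q.toMatrix 0)ᴴ * majOp p.1 p.2 * q.toMatrix 0 = ∑ r : MIdx N, ((gateE q p r : ℝ) : ℂ) • majOp r.1 r.2 := by
  cases q with
  | gate g e =>
    rw [QGate.toMatrix_gate, gateE]
    show (placeGate (k := 2) (n := N) e (M g))ᴴ * majOp p.1 p.2 * placeGate (k := 2) (n := N) e (M g) = _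
    rw [placeGate_eq_placeGate_blockEmb hq]
    exact conj_majOp_placeGate_blockEmb _ ((hM g).localGate e) p
  | oracle k e => exact absurd hq id

/-- The `SO(2N)` matrix of a nearest-neighbour gate is orthogonal. [cite: JozsaMiyake2008, Thm 3] -/
theorem gateE_mul_transpose (hM : ∀ g, IsMatchgate (M g)) {q : QGate (gateSet Op M) N}
    (hq : Matchgate.IsNearestNeighbour q) : gateE q * (gateE q)ᵀ = 1 := by
  cases q with
  | gate g e => exact embE_mul_transpose _ (base_add_two_le hq) ((hM g).localGate e).rotOf_mul_transpose
  | oracle k e => exact absurd hq id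

/-! ### Circuits: the rows of `E_T ⋯ E_1` -/

/-- **Row `p` of the total rotation `E_T ⋯ E_1` of a gate list** (JM08 eq. (8)), accumulated
from the LAST gate to the first: `rowVec p (q :: qs) = rowVec p qs · E_q`, `rowVec p [] = e_p`.
[cite: JozsaMiyake2008, §4 eq. (8)] -/
noncomputable def rowVec (p : MIdx N) : List (QGate (gateSet Op M) N) → MIdx N → ℝ
  | [] => Pi.single p 1
  | q :: qs => rowVec p qs ᵥ* gateE q

/-- `rowVec` is a right fold. [folklore] -/
theorem rowVec_eq_foldr (p : MIdx N) (qs : List (QGate (gateSet Op M) N)) :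
    rowVec p qs = qs.foldr (fun q v => v ᵥ* gateE q) (Pi.single p 1) := by
  induction qs with
  | nil => rfl
  | cons q qs ih => rw [rowVec, List.foldr_cons, ih]

/-- **Heisenberg evolution of a Majorana through a nearest-neighbour matchgate circuit**
(JM08 eq. (8)): `U_Cᴴ c_p U_C = ∑_q (rowVec p C)_q c_q`. [cite: JozsaMiyake2008, §4 eq. (8)] -/
theorem conj_majOp_circuit (hM : ∀ g, IsMatchgate (M g)) (qs : List (QGate (gateSet Op M) N))
    (hqs : ∀ q ∈ qs, Matchgate.IsNearestNeighbour q) (p : MIdx N) :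
    ((⟨qs⟩ : QCircuit (gateSet Op M) N).toMatrix 0)ᴴ * majOp p.1 p.2 * (⟨qs⟩ : QCircuit (gateSet Op M) N).toMatrix 0 =
      ∑ q : MIdx N, ((rowVec p qs q : ℝ) : ℂ) • majOp q.1 q.2 := by
  induction qs with
  | nil =>
    rw [QCircuit.toMatrix_nil, conjTranspose_one, Matrix.one_mul, Matrix.mul_one, rowVec]
    rw [Finset.sum_eq_single p]
    · simp
    · intro q _ hq; simp [Pi.single_eq_of_ne hq]
    · intro h; exact absurd (mem_univ p) h
  | cons q qs ih =>
    have hq : Matchgate.IsNearestNeighbour q := hqs q List.mem_cons_self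
    have e1 : ((⟨qs⟩ : QCircuit (gateSet Op M) N).toMatrix 0 * q.toMatrix 0)ᴴ * majOp p.1 p.2 *
        ((⟨qs⟩ : QCircuit (gateSet Op M) N).toMatrix 0 * q.toMatrix 0) =
        (q.toMatrix 0)ᴴ * (((⟨qs⟩ : QCircuit (gateSet Op M) N).toMatrix 0)ᴴ * majOp p.1 p.2 *
          (⟨qs⟩ : QCircuit (gateSet Op M) N).toMatrix 0) * q.toMatrix 0 := by
      rw [conjTranspose_mul]; simp only [Matrix.mul_assoc]
    rw [QCircuit.toMatrix_cons, e1, ih (fun q' hq' => hqs q' (List.mem_cons_of_mem q hq')), Finset.mul_sum,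
      Finset.sum_mul]
    simp_rw [Matrix.mul_smul, Matrix.smul_mul, conj_majOp_toMatrix hM hq, smul_sum, smul_smul]
    rw [Finset.sum_comm]
    simp only [rowVec]
    refine sum_congr rfl fun r _ => ?_
    rw [← Finset.sum_smul, vecMul, dotProduct]
    push_cast
    rfl

/-- An orthogonal step preserves the Euclidean norm of a row. [folklore] -/
theorem vecMul_dotProduct_vecMul_of_mul_transpose {ι : Type*} [Fintype ι] [DecidableEq ι] {E : Matrix ι ι ℝ}
    (hE : E * Eᵀ = 1)
    (v w : ι → ℝ) : (v ᵥ* E) ⬝ᵥ (w ᵥ* E) = v ⬝ᵥ w := by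
  rw [← mulVec_transpose E w, dotProduct_mulVec, vecMul_vecMul, hE, vecMul_one]

/-- **Rows of the total rotation are unit vectors**: `∑_q (rowVec p C)_q² = 1`. [cite: JozsaMiyake2008, Thm 3 (R ∈ SO(2n))] -/
theorem rowVec_dotProduct_self (hM : ∀ g, IsMatchgate (M g)) (qs : List (QGate (gateSet Op M) N))
    (hqs : ∀ q ∈ qs, Matchgate.IsNearestNeighbour q) (p : MIdx N) : rowVec p qs ⬝ᵥ rowVec p qs = 1 := by
  induction qs with
  | nil => simp [rowVec]
  | cons q qs ih =>
    rw [rowVec, vecMul_dotProduct_vecMul_of_mul_transpose (gateE_mul_transpose hM (hqs q List.mem_cons_self)),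
      ih (fun q' hq' => hqs q' (List.mem_cons_of_mem q hq'))]

end gates

/-! ### Products of two Majoranas on a basis state -/

/-- One-qubit labels are constant functions. [folklore] -/
theorem eq_const_qReg_one (x : QReg 1) : x = fun _ => x 0 := by
  funext i; rw [Subsingleton.elim i 0]

/-- Sums over one-qubit labels. [folklore] -/
theorem sum_qReg_one {K : Type*} [AddCommMonoid K] (f : QReg 1 → K) :
    ∑ x, f x = f (fun _ => false) + f (fun _ => true) := by
  rw [← (Equiv.funUnique (Fin 1) Bool).symm.sum_comp, Fintype.sum_bool, add_comm]
  rfl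

/-- Two constant one-qubit labels are equal iff their bits are. [folklore] -/
theorem const_eq_const_iff (a c : Bool) : ((fun _ : Fin 1 => a) = fun _ => c) ↔ a = c :=
  ⟨fun h => congrFun h 0, fun h => by rw [h]⟩

/-- `σ_b² = 1`. [folklore] -/
theorem σ_mul_self (b : Bool) : σ b * σ b = 1 := by
  ext x y
  rw [eq_const_qReg_one x, eq_const_qReg_one y, Matrix.mul_apply, sum_qReg_one, Matrix.one_apply]
  simp only [σ_apply_const, const_eq_const_iff]
  cases b <;> cases x 0 <;> cases y 0 <;> simp

/-- `X Y = i Z`. [folklore] -/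
theorem σX_mul_σY : σ false * σ true = I • σZ := by
  ext x y
  rw [eq_const_qReg_one x, eq_const_qReg_one y, Matrix.mul_apply, sum_qReg_one, Matrix.smul_apply, σZ]
  simp only [σ_apply_const, diagonal_apply, const_eq_const_iff]
  cases x 0 <;> cases y 0 <;> simp [bsign]

/-- `Y X = -i Z`. [folklore] -/
theorem σY_mul_σX : σ true * σ false = -(I • σZ) := by
  ext x y
  rw [eq_const_qReg_one x, eq_const_qReg_one y, Matrix.mul_apply, sum_qReg_one, Matrix.neg_apply,
    Matrix.smul_apply, σZ]
  simp only [σ_apply_const, diagonal_apply, const_eq_const_iff]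
  cases x 0 <;> cases y 0 <;> simp [bsign]

/-- **Two Majoranas of the same wire multiply locally**: `c_{i,b} c_{i,b'} = (σ_b σ_b')_i` (the JW
strings cancel). [cite: JozsaMiyake2008, §5 (Z_k = -i c_{2k-1} c_{2k})] -/
theorem majOp_mul_majOp_same (i : Fin N) (b b' : Bool) :
    majOp i b * majOp i b' = placeGate (wire i) (σ b * σ b') := by
  rw [majOp, majOp, Matrix.mul_assoc, ← Matrix.mul_assoc (placeGate _ _) (signDiag _),
    ← signDiag_mul_placeGate_comm _ (wiresBelow_not_mem_range_wire i), Matrix.mul_assoc,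
    ← Matrix.mul_assoc (signDiag _), signDiag_mul_self, Matrix.one_mul, placeGate_mul_holds]

/-- `c_{i,b}² = 1`. [cite: JozsaMiyake2008, §4 eq. (4)] -/
theorem majOp_mul_self (i : Fin N) (b : Bool) : majOp i b * majOp i b = 1 := by
  rw [majOp_mul_majOp_same, σ_mul_self, placeGate_one]

/-- `c_{i,X} c_{i,Y} = i Z_i`. [cite: JozsaMiyake2008, §5 (Z_k = -i c_{2k-1} c_{2k})] -/
theorem majOp_false_mul_true (i : Fin N) : majOp i false * majOp i true = I • signDiag {i} := by
  rw [majOp_mul_majOp_same, show σ false * σ true = I • σZ from σX_mul_σY, placeGate_smul_mg, placeGate_wire_σZ]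

/-- `c_{i,Y} c_{i,X} = -i Z_i`. [cite: JozsaMiyake2008, §4 eq. (4) and §5] -/
theorem majOp_true_mul_false (i : Fin N) : majOp i true * majOp i false = -(I • signDiag {i}) := by
  rw [majOp_mul_majOp_same, show σ true * σ false = -(I • σZ) from σY_mul_σX, ← neg_one_smul ℂ,
    placeGate_smul_mg, placeGate_smul_mg, placeGate_wire_σZ, neg_one_smul]

/-- **Majoranas of different wires have vanishing diagonal products on basis states**
(`c_{i,b} c_{i',b'}` flips the two bits `i ≠ i'`). [cite: JozsaMiyake2008, §4 (the monomials c_ν₁ c_ν₂ are product operators)] -/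
theorem majOp_mul_majOp_apply_self_of_ne {i i' : Fin N} (h : i ≠ i') (b b' : Bool) (x : QReg N) :
    (majOp i b * majOp i' b') x x = 0 := by
  rw [Matrix.mul_apply]
  refine sum_eq_zero fun y _ => ?_
  rw [majOp_apply, majOp_apply]
  by_cases h1 : ∀ k, k ≠ i → x k = y k
  · by_cases h2 : ∀ k, k ≠ i' → y k = x k
    · have hxi : x i = y i := (h2 i h).symm
      rw [if_pos h1, σ_apply_const, if_pos hxi, mul_zero, zero_mul]
    · rw [if_neg h2, mul_zero, mul_zero]
  · rw [if_neg h1, mul_zero, zero_mul]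

/-- **The diagonal entries `⟨x| c_q c_r |x⟩` on a basis state**: `1` if `q = r`, `± i (-1)^{x_i}` for
the two Majoranas of one wire `i`, `0` for different wires. [cite: JozsaMiyake2008, §4 eq. (10)] -/
noncomputable def pairDiag (x : QReg N) (q r : MIdx N) : ℂ :=
  if q.1 = r.1 then (if q.2 = r.2 then 1 else if r.2 then I * bsign (x q.1) else -(I * bsign (x q.1))) else 0

/-- The diagonal entries of `c_q c_r` on a basis state are `pairDiag`. [cite: JozsaMiyake2008, §4 eq. (10)] -/
theorem majOp_mul_majOp_apply_self (x : QReg N) (q r : MIdx N) :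
    (majOp q.1 q.2 * majOp r.1 r.2) x x = pairDiag x q r := by
  obtain ⟨i, b⟩ := q
  obtain ⟨i', b'⟩ := r
  unfold pairDiag
  by_cases h : i = i'
  · subst h
    simp only [if_true]
    cases b <;> cases b'
    · rw [majOp_mul_self]; simp
    · rw [majOp_false_mul_true, Matrix.smul_apply, signDiag, diagonal_apply_eq, prod_singleton]; simp
    · rw [majOp_true_mul_false, Matrix.neg_apply, Matrix.smul_apply, signDiag, diagonal_apply_eq, prod_singleton]
      simp
    · rw [majOp_mul_self]; simp
  · rw [majOp_mul_majOp_apply_self_of_ne h, if_neg h]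

/-! ### The observable `Z₀` and the acceptance probability -/

/-- **Evaluation of JM08 eq. (10) on a basis state**: the real part of
`-i ∑_{q,r} v₀(q) v₁(r) ⟨x|c_q c_r|x⟩` is `zExp x v₀ v₁`. [cite: JozsaMiyake2008, §4 eq. (10)] -/
theorem re_neg_I_mul_sum_pairDiag (x : QReg N) (v₀ v₁ : MIdx N → ℝ) :
    (-I * ∑ q : MIdx N, ∑ r : MIdx N, ((v₀ q : ℂ) * v₁ r) * pairDiag x q r).re = zExp x v₀ v₁ := by
  have hS : ∀ q : MIdx N, ∑ r : MIdx N, ((v₀ q : ℂ) * v₁ r) * pairDiag x q r =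
      ∑ b' : Bool, ((v₀ q : ℂ) * v₁ (q.1, b')) * pairDiag x q (q.1, b') := by
    intro q
    rw [Fintype.sum_prod_type, Finset.sum_eq_single q.1]
    · intro i _ hi
      refine sum_eq_zero fun b' _ => ?_
      rw [pairDiag, if_neg (Ne.symm hi), mul_zero]
    · intro h; exact absurd (mem_univ _) h
  simp_rw [hS]
  rw [Fintype.sum_prod_type, neg_mul, Complex.neg_re, Complex.mul_re, Complex.I_re, Complex.I_im, zero_mul,
    one_mul, zero_sub, neg_neg, Complex.im_sum, zExp]
  refine sum_congr rfl fun i _ => ?_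
  rw [Fintype.sum_bool, Fintype.sum_bool, Fintype.sum_bool]
  rcases Bool.eq_false_or_eq_true (x i) with hx | hx <;> simp [pairDiag, bsign, hx] <;> ring

/-- Diagonal entries of a diagonal observable in the Heisenberg picture:
`⟨x|Uᴴ diag(d) U|x⟩ = ∑_y d_y |U_{yx}|²`. [folklore] -/
theorem conjTranspose_mul_diagonal_mul_apply_self {ι : Type*} [Fintype ι] [DecidableEq ι]
    (U : Matrix ι ι ℂ) (d : ι → ℂ) (x : ι) :
    (Uᴴ * diagonal d * U) x x = ∑ y, d y * ((‖U y x‖ ^ 2 : ℝ) : ℂ) := by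
  rw [Matrix.mul_assoc, Matrix.mul_apply]
  refine sum_congr rfl fun y _ => ?_
  rw [diagonal_mul, conjTranspose_apply, Complex.star_def, mul_left_comm, Complex.conj_mul']
  push_cast
  ring

/-- The amplitudes of a circuit run on a basis state are a column of its matrix. [folklore] -/
theorem mulVec_basisState_apply {n : ℕ} (U : Matrix (QReg n) (QReg n) ℂ) (x y : QReg n) :
    (U *ᵥ basisState x) y = U y x := by
  simp [Matrix.mulVec, dotProduct, basisState_apply]

section circuits

variable {Op : Type} {M : Op → Matrix (QReg 2) (QReg 2) ℂ} {n m : ℕ}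

/-- The matchgate gate set of allowable matchgates is unitary. [cite: JozsaMiyake2008, §1 eq. (1)] -/
theorem gateSet_isUnitary (hM : ∀ g, IsMatchgate (M g)) : (gateSet Op M).IsUnitary :=
  fun g => (hM g).mem_unitaryGroup

/-- **`p₁ = (1 - ⟨Z₀⟩)/2` with `⟨Z₀⟩` computed from two rows of the total rotation** — Theorem 1 of
Jozsa–Miyake in exact arithmetic: for a nearest-neighbour circuit of allowable matchgates on
`n + m ≥ 1` wires run on `|x⟩|0^m⟩`, the probability that wire `0` reads `1` is
`(1 - zExp (x 0^m) v₀ v₁)/2` where `v₀, v₁` are the rows `(0,X), (0,Y)` of `E_T ⋯ E_1`.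
[cite: JozsaMiyake2008, Thm 1 and §4 eq. (10)] -/
theorem acceptProb_eq (hM : ∀ g, IsMatchgate (M g)) (C : QCircuit (gateSet Op M) (n + m))
    (hC : ∀ q ∈ C.gates, Matchgate.IsNearestNeighbour q) (x : QReg n) (hN : 0 < n + m) :
    C.acceptProb 0 x = (1 - zExp (padInput x m) (rowVec ((⟨0, hN⟩ : Fin (n + m)), false) C.gates)
      (rowVec ((⟨0, hN⟩ : Fin (n + m)), true) C.gates)) / 2 := by
  obtain ⟨gs⟩ := C
  set w0 : Fin (n + m) := ⟨0, hN⟩ with hw0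
  set x' : QReg (n + m) := padInput x m with hx'
  set U : Matrix (QReg (n + m)) (QReg (n + m)) ℂ := (⟨gs⟩ : QCircuit (gateSet Op M) (n + m)).toMatrix 0 with hU
  -- (a) the acceptance probability and the normalisation as sums of squared amplitudes
  have ha : (⟨gs⟩ : QCircuit (gateSet Op M) (n + m)).acceptProb 0 x =
      ∑ y : QReg (n + m), if y w0 then ‖U y x'‖ ^ 2 else 0 := by
    unfold QCircuit.acceptProb
    refine sum_congr rfl fun y _ => ?_
    rw [dif_pos hN, QCircuit.runOn, mulVec_basisState_apply]
  have hb : ∑ y : QReg (n + m), ‖U y x'‖ ^ 2 = 1 := by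
    have := QCircuit.normSq_runOn_basisState (gateSet_isUnitary hM) 0 (⟨gs⟩ : QCircuit (gateSet Op M) (n + m)) x
    rw [Cryptography.normSq, QCircuit.runOn] at this
    simpa only [mulVec_basisState_apply] using this
  -- (c) the Heisenberg-picture expectation of `Z₀`
  have hc : ((Uᴴ * signDiag {w0} * U) x' x').re = ∑ y : QReg (n + m), (if y w0 then -1 else 1) * ‖U y x'‖ ^ 2 := by
    rw [signDiag, conjTranspose_mul_diagonal_mul_apply_self, Complex.re_sum]
    refine sum_congr rfl fun y _ => ?_
    rw [prod_singleton, Complex.re_mul_ofReal]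
    cases y w0 <;> simp [bsign]
  -- (d)–(f) `Z₀ = -i c_{0,X} c_{0,Y}` and JM08 eq. (10)
  have hUU : U * Uᴴ = 1 := by
    have := Matrix.mem_unitaryGroup_iff.1
      (QCircuit.toMatrix_mem_unitaryGroup_holds (gateSet_isUnitary hM) 0 (⟨gs⟩ : QCircuit (gateSet Op M) (n + m)))
    rwa [star_eq_conjTranspose] at this
  have hd : signDiag {w0} = -I • (majOp w0 false * majOp w0 true) := by
    rw [majOp_false_mul_true, smul_smul]; simp
  have he : Uᴴ * (majOp w0 false * majOp w0 true) * U =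
      (∑ q : MIdx (n + m), ((rowVec (w0, false) gs q : ℝ) : ℂ) • majOp q.1 q.2) *
        ∑ r : MIdx (n + m), ((rowVec (w0, true) gs r : ℝ) : ℂ) • majOp r.1 r.2 := by
    rw [← conj_majOp_circuit hM gs hC (w0, false), ← conj_majOp_circuit hM gs hC (w0, true)]
    rw [show Uᴴ * majOp w0 false * U * (Uᴴ * majOp w0 true * U) = Uᴴ * majOp w0 false * (U * Uᴴ) * majOp w0 true * U by
      simp only [Matrix.mul_assoc], hUU, Matrix.mul_one]
    simp only [Matrix.mul_assoc]
  have hf : ((Uᴴ * signDiag {w0} * U) x' x').re = zExp x' (rowVec (w0, false) gs) (rowVec (w0, true) gs) := by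
    rw [hd, Matrix.mul_smul, Matrix.smul_mul, Matrix.smul_apply, he, Finset.sum_mul, Matrix.sum_apply]
    simp_rw [Finset.mul_sum, Matrix.sum_apply, Matrix.smul_mul, Matrix.mul_smul, Matrix.smul_apply, smul_eq_mul,
      majOp_mul_majOp_apply_self]
    rw [← re_neg_I_mul_sum_pairDiag x']
    congr 2
    refine sum_congr rfl fun q _ => sum_congr rfl fun r _ => ?_
    ring
  -- assemble
  have key : (1 : ℝ) - 2 * (⟨gs⟩ : QCircuit (gateSet Op M) (n + m)).acceptProb 0 x =
      zExp x' (rowVec (w0, false) gs) (rowVec (w0, true) gs) := by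
    rw [← hf, hc, ha]
    have hsplit : ∑ y : QReg (n + m), (if y w0 then -1 else 1 : ℝ) * ‖U y x'‖ ^ 2 =
        ∑ y : QReg (n + m), ‖U y x'‖ ^ 2 - 2 * ∑ y : QReg (n + m), (if y w0 then ‖U y x'‖ ^ 2 else 0) := by
      rw [Finset.mul_sum, ← Finset.sum_sub_distrib]
      refine sum_congr rfl fun y _ => ?_
      cases y w0
      · simp
      · simp
        ring
    rw [hsplit, hb]
  show (⟨gs⟩ : QCircuit (gateSet Op M) (n + m)).acceptProb 0 x = _
  linarith

end circuits

end Literature.Computability.QuantumComplexity.Matchgate
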